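import Mathlib
import Summits.RiemannHypothesis.RiemannHypothesis.Theorems.IntegerScrewExitGreenLower
import Summits.RiemannHypothesis.RiemannHypothesis.Theorems.IntegerScrewExitGreenSharp
import HarnessLib

/-!
# Route `IntegerScrew` — the Green function of the exit-death chain, SHARP form from BELOW:
# `log R/log x − κ′·log R/log²x ≤ Γ(x)` with NO restriction on the window (CONTINUUM-LIMIT §26.1)

Companion of `IntegerScrewExitGreenSharp` (the upper half `Γ(x) ≤ log R/log x + κ·log R/log²x`).  With a lower
Chebyshev-strength Mertens constant `c′` (`log n − c′ ≤ ψ₁(n)`; the tree gives `c′ = 1`):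

* **`le_exitGamma_sharp`** — if `0 ≤ κ′` and `2(c′ + log 2) + (39/25)κ′/log(Q+1) ≤ κ′` then
  `log R/log x − κ′·log R/log²x ≤ Γ(x)` on the window `Q < x ≤ R` (e.g. `c′ = 1`, `κ′ = 5` for `Q ≥ 125`):
  downward induction with the potential `L/s − κ′L/s²`, the square part from below
  (`IntegerScrewExitGreenLower.sum_vonMangoldt_div_mul_inv_sq_ge`), the cube part from above
  (`IntegerScrewExitGreenSharp.sum_vonMangoldt_div_mul_inv_cube_le`); the top-layer defect `1 − L/y + κ′L/(2y²)`
  (`y = log x + log⌊R/x⌋ ∈ [L − log 2, L]`) is `≥ 0` as soon as `κ′ ≥ 2 log 2`;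
* `le_exitGamma_sharp'` — the constant form `(1 − κ′/log(Q+1))·log R/log x ≤ Γ(x)`.

RH-free, elementary.  Nothing in this file bears on the truth of RH.
References: CONTINUUM-LIMIT §25–26 (rh-explicit A6-PIVOT); M. Suzuki, J. Lond. Math. Soc. (2) 108 (2023)
1448–1487 [Suzuki2023] for the screw matrices this serves.
-/

noncomputable section

set_option linter.dupNamespace false -- D-0017: `Summit.<S>.<S>.…` is the designed namespace

namespace Summit.RiemannHypothesis.RiemannHypothesis.Theorems.IntegerScrew

open Finset Real
open ArithmeticFunction (vonMangoldt)

/-! ### The Green function from below, sharp form -/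

/-- The hypothesis `2(c′ + log 2) + (39/25)κ′/log(Q+1) ≤ κ′` with `c′, κ′ ≥ 0` forces `2 log 2 ≤ κ′`. -/
theorem two_mul_log_two_le_of_hyp {c' κ' ℓ₁ : ℝ} (hc' : 0 ≤ c') (hκ'0 : 0 ≤ κ') (hℓ : 0 < ℓ₁)
    (hκ' : 2 * (c' + Real.log 2) + 39 / 25 * κ' / ℓ₁ ≤ κ') : 2 * Real.log 2 ≤ κ' := by
  have : 0 ≤ 39 / 25 * κ' / ℓ₁ := by positivity
  linarith

/-- **`log R/log x − κ′·log R/log²x ≤ Γ(x)` (CONTINUUM-LIMIT §26.1, lower half).**  Let `1 ≤ Q`, `0 ≤ κ′`, a lower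
Chebyshev-strength Mertens constant `c′` (`log n − c′ ≤ ψ₁(n) = Σ_{k≤n}Λ(k)/k` for `1 ≤ n ≤ R`; the tree gives
`c′ = 1`), and `2(c′ + log 2) + (39/25)κ′/log(Q+1) ≤ κ′`.  Then `log R/log x − κ′ log R/log²x ≤ Γ(x)` for every
`Q < x ≤ R`.  Proof: downward induction with the potential `L/s − κ′L/s²`; the square part from below
(`sum_vonMangoldt_div_mul_inv_sq_ge`), the cube part from above (`sum_vonMangoldt_div_mul_inv_cube_le`); with
`y = log x + log⌊R/x⌋ ∈ [L − log 2, L]` the top-layer defect `1 − L/y + κ′L/(2y²)` is `≥ 0` as soon as `κ′ ≥ 2 log 2`. -/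
theorem le_exitGamma_sharp {R Q : ℕ} (hQ : 1 ≤ Q) {c' κ' : ℝ} (hκ'0 : 0 ≤ κ')
    (hψ : ∀ n, 1 ≤ n → n ≤ R → Real.log n - c' ≤ ∑ k ∈ Icc 1 n, vonMangoldt k / k)
    (hκ' : 2 * (c' + Real.log 2) + 39 / 25 * κ' / Real.log ((Q : ℝ) + 1) ≤ κ') :
    ∀ x, Q < x → x ≤ R →
      Real.log R / Real.log x - κ' * Real.log R / Real.log x ^ 2 ≤ exitGamma R Q x := by
  suffices H : ∀ k x, R + 1 - x = k → Q < x → x ≤ R →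
      Real.log R / Real.log x - κ' * Real.log R / Real.log x ^ 2 ≤ exitGamma R Q x from
    fun x hQx hxR => H _ x rfl hQx hxR
  have hlog2 : 0 < Real.log 2 := Real.log_pos (by norm_num)
  have hlogQ1pos : 0 < Real.log ((Q : ℝ) + 1) := Real.log_pos (by
    have : (1 : ℝ) ≤ Q := by exact_mod_cast hQ
    linarith)
  set L := Real.log R with hLdef
  intro k
  induction k using Nat.strong_induction_on with
  | _ k ih =>
    intro x hk hQx hxR
    -- c′ ≥ 0 (from hψ at n = 1), hence κ′ ≥ 2 log 2 ≥ 0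
    have hc' : 0 ≤ c' := by
      have := hψ 1 le_rfl (by omega)
      simp [ArithmeticFunction.vonMangoldt_apply_one] at this
      linarith
    have hκ'2 : 2 * Real.log 2 ≤ κ' := two_mul_log_two_le_of_hyp hc' hκ'0 hlogQ1pos hκ'
    have hx2 : (2 : ℝ) ≤ x := by exact_mod_cast (show 2 ≤ x by omega)
    have hxR' : (x : ℝ) ≤ R := by exact_mod_cast hxR
    have hlogx : 0 < Real.log x := Real.log_pos (by linarith)
    have hlogQ1 : Real.log ((Q : ℝ) + 1) ≤ Real.log x :=
      Real.log_le_log (by positivity) (by exact_mod_cast hQx)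
    have hsL : Real.log x ≤ L := Real.log_le_log (by linarith) hxR'
    have hLpos : 0 < L := hlogx.trans_le hsL
    set s := Real.log x with hs
    rw [exitGamma_eq ⟨hQx, hxR⟩]
    have hRx : 1 ≤ R / x := Nat.div_pos hxR (by omega)
    -- Step 1: IH inside the sum (over Icc 1 (R/x): the n = 1 term vanishes)
    have hdrop : ∑ n ∈ Icc 2 (R / x), vonMangoldt n / n * (exitGamma R Q (x * n) / Real.log ((x * n : ℕ) : ℝ)) =
        ∑ n ∈ Icc 1 (R / x), vonMangoldt n / n * (exitGamma R Q (x * n) / Real.log ((x * n : ℕ) : ℝ)) := by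
      have hI : Icc 1 (R / x) = insert 1 (Icc 2 (R / x)) := by
        ext n; simp only [Finset.mem_insert, Finset.mem_Icc]; omega
      rw [hI, Finset.sum_insert (by simp)]
      simp [ArithmeticFunction.vonMangoldt_apply_one]
    have hsum : ∑ n ∈ Icc 1 (R / x), vonMangoldt n / n * (L / (s + Real.log n) ^ 2) -
          ∑ n ∈ Icc 1 (R / x), vonMangoldt n / n * (κ' * L / (s + Real.log n) ^ 3) ≤
        ∑ n ∈ Icc 1 (R / x), vonMangoldt n / n * (exitGamma R Q (x * n) / Real.log ((x * n : ℕ) : ℝ)) := by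
      rw [← Finset.sum_sub_distrib]
      refine Finset.sum_le_sum fun n hn => ?_
      have hn' := Finset.mem_Icc.1 hn
      rcases eq_or_lt_of_le hn'.1 with h1 | h1
      · -- n = 1: Λ(1) = 0, both sides vanish
        subst h1
        simp [ArithmeticFunction.vonMangoldt_apply_one]
      rw [← mul_sub]
      refine mul_le_mul_of_nonneg_left ?_ (div_nonneg ArithmeticFunction.vonMangoldt_nonneg (Nat.cast_nonneg _))
      have hxn : x * n ≤ R := by
        have := (Nat.le_div_iff_mul_le (by omega)).1 hn'.2
        rwa [mul_comm] at this
      have hn1 : (1 : ℝ) ≤ n := by exact_mod_cast hn'.1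
      have hlogn : 0 ≤ Real.log n := Real.log_nonneg hn1
      have hlogxn : Real.log ((x * n : ℕ) : ℝ) = s + Real.log n := by
        push_cast
        rw [Real.log_mul (by positivity) (by positivity)]
      have hpos : 0 < s + Real.log n := by linarith
      have hlt : x < x * n := by nlinarith
      have hQxn : Q < x * n := lt_trans hQx hlt
      have hG := ih (R + 1 - x * n) (by omega) (x * n) rfl hQxn hxn
      rw [hlogxn] at hG ⊢
      calc L / (s + Real.log n) ^ 2 - κ' * L / (s + Real.log n) ^ 3
          = (L / (s + Real.log n) - κ' * L / (s + Real.log n) ^ 2) / (s + Real.log n) := by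
            field_simp
        _ ≤ exitGamma R Q (x * n) / (s + Real.log n) := div_le_div_of_nonneg_right hG hpos.le
    -- Step 2: the two Abel steps (square from below, cube from above)
    have hκL : 0 ≤ κ' * L := mul_nonneg hκ'0 hLpos.le
    have habel1 := sum_vonMangoldt_div_mul_inv_sq_ge (N := R / x) hRx
      (fun n hn hnR => hψ n hn (hnR.trans (Nat.div_le_self R x))) hlogx hLpos.le
    have habel2 := sum_vonMangoldt_div_mul_inv_cube_le (N := R / x) hRx hlogx hκL
    -- Step 3: y = s + log ⌊R/x⌋ ∈ [L − log 2, L]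
    set y := s + Real.log ((R / x : ℕ) : ℝ) with hy
    have hNpos : (0 : ℝ) < ((R / x : ℕ) : ℝ) := by exact_mod_cast hRx
    have hyL : y ≤ L := by
      have hprod : (x : ℝ) * ((R / x : ℕ) : ℝ) ≤ R := by exact_mod_cast Nat.mul_div_le R x
      rw [hy, hs, hLdef, ← Real.log_mul (by positivity) hNpos.ne']
      exact Real.log_le_log (by positivity) hprod
    have hLy : L - Real.log 2 ≤ y := by
      have h2N : (R : ℝ) ≤ 2 * ((x : ℝ) * ((R / x : ℕ) : ℝ)) := by
        have h := Nat.lt_div_mul_add (a := R) (b := x) (by omega)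
        have h' : (R : ℝ) < (R / x : ℕ) * x + x := by exact_mod_cast h
        have hNx : (x : ℝ) ≤ (R / x : ℕ) * x := by
          have : (1 : ℝ) ≤ (R / x : ℕ) := by exact_mod_cast hRx
          nlinarith
        nlinarith
      have hRpos : (0 : ℝ) < R := by exact_mod_cast (show 0 < R by omega)
      have : Real.log R ≤ Real.log 2 + y := by
        rw [hy, hs, ← Real.log_mul (by positivity) hNpos.ne', ← Real.log_mul (by norm_num) (by positivity)]
        exact Real.log_le_log hRpos h2N
      linarith
    have hypos : 0 < y := by
      have := Real.log_natCast_nonneg (R / x); rw [hy]; linarith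
    -- Step 4: the potential inequality
    --   L/s − κ′L/s² ≤ 1 + [L(1/s − 1/y) − (c′+log 2)L/s²] − [(39/50)κ′L/s³ + (κ′L/2)(1/s² − 1/y²)]
    have hkey : L / s - κ' * L / s ^ 2 ≤
        1 + (L * (1 / s - 1 / y) - (c' + Real.log 2) * (L / s ^ 2)) -
          (39 / 50 * (κ' * L / s ^ 3) + κ' * L / 2 * (1 / s ^ 2 - 1 / y ^ 2)) := by
      -- (a) the top-layer defect 0 ≤ 1 − L/y + κ′L/(2y²): 2y² − 2Ly + κ′L = 2y(y − L) + κ′L ≥ −2y·log 2 + 2L·log 2 ≥ 0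
      have ha : 0 ≤ 1 - L / y + κ' * L / 2 * (1 / y ^ 2) := by
        have hnum : 0 ≤ 2 * y ^ 2 - 2 * L * y + κ' * L := by
          nlinarith [hLy, hyL, hκ'2, hLpos, hypos, hlog2]
        have : 1 - L / y + κ' * L / 2 * (1 / y ^ 2) = (2 * y ^ 2 - 2 * L * y + κ' * L) / (2 * y ^ 2) := by
          field_simp
        rw [this]; positivity
      -- (b) (c′ + log 2) + (39/50)κ′/s ≤ κ′/2, from hκ' and s ≥ log(Q+1)
      have hb : (c' + Real.log 2) + 39 / 50 * (κ' / s) ≤ κ' / 2 := by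
        have h1 : κ' / s ≤ κ' / Real.log ((Q : ℝ) + 1) := div_le_div_of_nonneg_left hκ'0 hlogQ1pos hlogQ1
        have h2 : 39 / 25 * κ' / Real.log ((Q : ℝ) + 1) = 39 / 25 * (κ' / Real.log ((Q : ℝ) + 1)) := by ring
        rw [h2] at hκ'
        linarith
      -- (c) the s-terms are (L/s²)·[κ′/2 − (c′ + log 2) − (39/50)κ′/s] ≥ 0
      have hLs2 : 0 ≤ L / s ^ 2 := by positivity
      have hc : κ' * L / s ^ 2 - (c' + Real.log 2) * (L / s ^ 2) - 39 / 50 * (κ' * L / s ^ 3) -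
          κ' * L / 2 * (1 / s ^ 2) =
          L / s ^ 2 * (κ' / 2 - ((c' + Real.log 2) + 39 / 50 * (κ' / s))) := by
        field_simp
        ring
      have hc' : 0 ≤ κ' * L / s ^ 2 - (c' + Real.log 2) * (L / s ^ 2) - 39 / 50 * (κ' * L / s ^ 3) -
          κ' * L / 2 * (1 / s ^ 2) := by
        rw [hc]; exact mul_nonneg hLs2 (by linarith)
      have hexp : L * (1 / s - 1 / y) = L / s - L / y := by ring
      have hexp2 : κ' * L / 2 * (1 / s ^ 2 - 1 / y ^ 2) = κ' * L / 2 * (1 / s ^ 2) - κ' * L / 2 * (1 / y ^ 2) := by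
        ring
      rw [hexp, hexp2]
      linarith [ha, hc']
    calc L / s - κ' * L / s ^ 2
        ≤ 1 + (L * (1 / s - 1 / y) - (c' + Real.log 2) * (L / s ^ 2)) -
            (39 / 50 * (κ' * L / s ^ 3) + κ' * L / 2 * (1 / s ^ 2 - 1 / y ^ 2)) := hkey
      _ ≤ 1 + (∑ n ∈ Icc 1 (R / x), vonMangoldt n / n * (L / (s + Real.log n) ^ 2) -
            ∑ n ∈ Icc 1 (R / x), vonMangoldt n / n * (κ' * L / (s + Real.log n) ^ 3)) := by
          linarith [habel1, habel2]
      _ ≤ 1 + ∑ n ∈ Icc 1 (R / x), vonMangoldt n / n * (exitGamma R Q (x * n) / Real.log ((x * n : ℕ) : ℝ)) := by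
          linarith [hsum]
      _ = 1 + ∑ n ∈ Icc 2 (R / x), vonMangoldt n / n * (exitGamma R Q (x * n) / Real.log ((x * n : ℕ) : ℝ)) := by
          rw [hdrop]

/-- **Constant form of `le_exitGamma_sharp`**: under the same hypotheses,
`(1 − κ′/log(Q+1))·log R/log x ≤ Γ(x)` on the window (feed `B := 1 − κ′/log(Q+1)` to THEOREM A's chain; it is
`≥ 0` as soon as `log(Q+1) ≥ κ′`). -/
theorem le_exitGamma_sharp' {R Q : ℕ} (hQ : 1 ≤ Q) {c' κ' : ℝ} (hκ'0 : 0 ≤ κ')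
    (hψ : ∀ n, 1 ≤ n → n ≤ R → Real.log n - c' ≤ ∑ k ∈ Icc 1 n, vonMangoldt k / k)
    (hκ' : 2 * (c' + Real.log 2) + 39 / 25 * κ' / Real.log ((Q : ℝ) + 1) ≤ κ') :
    ∀ x, Q < x → x ≤ R →
      (1 - κ' / Real.log ((Q : ℝ) + 1)) * Real.log R / Real.log x ≤ exitGamma R Q x := by
  intro x hQx hxR
  have h := le_exitGamma_sharp hQ hκ'0 hψ hκ' x hQx hxR
  have hlogQ1pos : 0 < Real.log ((Q : ℝ) + 1) := Real.log_pos (by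
    have : (1 : ℝ) ≤ Q := by exact_mod_cast hQ
    linarith)
  have hx2 : (2 : ℝ) ≤ x := by exact_mod_cast (show 2 ≤ x by omega)
  have hlogx : 0 < Real.log x := Real.log_pos (by linarith)
  have hlogQ1 : Real.log ((Q : ℝ) + 1) ≤ Real.log x :=
    Real.log_le_log (by positivity) (by exact_mod_cast hQx)
  have hL : 0 ≤ Real.log R := by
    have hxR' : (x : ℝ) ≤ R := by exact_mod_cast hxR
    exact hlogx.le.trans (Real.log_le_log (by linarith) hxR')
  have h1 := mul_div_sq_le_div_mul_div hκ'0 hL hlogQ1pos hlogQ1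
  calc (1 - κ' / Real.log ((Q : ℝ) + 1)) * Real.log R / Real.log x
      = Real.log R / Real.log x - κ' / Real.log ((Q : ℝ) + 1) * Real.log R / Real.log x := by ring
    _ ≤ Real.log R / Real.log x - κ' * Real.log R / Real.log x ^ 2 := by linarith
    _ ≤ exitGamma R Q x := h

end Summit.RiemannHypothesis.RiemannHypothesis.Theorems.IntegerScrew

end
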